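import Mathlib.FieldTheory.AlgebraicClosure
import Mathlib.Analysis.SpecialFunctions.Complex.Log
import Mathlib.LinearAlgebra.Dimension.Finrank
import Mathlib.LinearAlgebra.Prod
import HarnessLib

/-!
# Barrier (Schanuel): Waldschmidt's theorem for `G_a^{d₀} × G_m^{d₁}` and Roy's refinement (Roy 1992, Theorems 1–2)

Third companion on the chain behind the named fact
`Literature.Barriers.Schanuel.roy1992_strongSixExponentials` (Roy 1992, §4 Corollary 2, the strong six
exponentials theorem). The first two companions
(`Literature.Barriers.Schanuel.AlgebraicIndependenceOfLogarithmsSixExpProofs`,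
`Literature.Barriers.Schanuel.AlgebraicIndependenceOfLogarithmsThm4Proofs`) prove
`roy1992_thm4 → roy1992_cor1 → roy1992_strongSixExponentials`; the present file vendors, as
named facts and exactly as printed, the two theorems of §1 from which Theorem 4 is deduced in
print (pp. 34–37): **Theorem 1**, M. Waldschmidt's transcendence theorem (Theorem 4.1 of
[Waldschmidt1988] applied to the linear algebraic group `G_a^{d₀} × G_m^{d₁}`, whose tangent
space at the neutral element is identified with `K^{d₀} × K^{d₁}`), and **Theorem 2**, Roy's
refinement of it (proved in §§2–3 of [Roy1992] from Theorem 1). Theorem 1 is the deep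
transcendence input of the whole chain (its printed proof uses an auxiliary function and
Philippon's zero estimate [Waldschmidt1988, §§6–7]); nothing is asserted here.

## What the sources print

* [Roy1992, Notations p. 24]: `K = ℂ` (or `ℂ_p`); `L` = the `ℚ`-subspace of `K` generated by the
  logarithms of algebraic numbers ("If `K = ℂ`, `L` is the set of the logarithms of the non-zero
  elements of `ℚ̄`"); `ω = 2πi` if `K = ℂ`; for `F' ⊂ F` fields, "an `F`-vector subspace `T` of `V`
  is rational over `F'` if it is generated (over `F`) by elements of `V'`" and "`f : V₁ → V₂` is
  rational over `F'` if `f(V₁') ⊆ V₂'`" (Bourbaki); "For each integer `d > 0`, we put on the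
  `K`-vector space `K^d` the `ℚ̄`-structure `ℚ̄^d` and the `ℚ`-structure `ℚ^d`."
* [Roy1992, §1 Theorem 1 (M. Waldschmidt), p. 25] ("It is Theorem 4.1 of [W3] applied to a linear
  algebraic group `G_a^{d₀} × G_m^{d₁}`. In our formulation, we identify the tangent space at the
  neutral element of this group with `K^{d₀} × K^{d₁}`"): "Let `d₀, d₁` be integers `≥ 0`, `Y` be
  a finite dimensional `ℚ`-vector subspace of `K^{d₀} × K^{d₁}` contained in `ℚ̄^{d₀} × L^{d₁}`,
  `W` be a `K`-vector subspace of `K^{d₀} × K^{d₁}` which is rational over `ℚ̄`, `V` be a `K`-vector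
  subspace of `K^{d₀} × K^{d₁}` containing `Y` and `W`. If `V ≠ K^{d₀} × K^{d₁}`, there exists a
  surjective `K`-linear mapping `s : K^{d₀} × K^{d₁} → K^{d₀'} × K^{d₁'}` satisfying
  `s(ℚ̄^{d₀} × 0) ⊆ ℚ̄^{d₀'} × 0` and `s(0 × ℚ^{d₁}) ⊆ 0 × ℚ^{d₁'}`, such that, letting `Y' = s(Y)`,
  `W' = s(W)`, `V' = s(V)`, `Ω = 0 × ωℚ^{d₁}`, `Ω' = 0 × ωℚ^{d₁'}`, we have `W' ≠ K^{d₀'} × K^{d₁'}`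
  and `(d₁' − dim_ℚ(Y' ∩ Ω') + dim_ℚ(Y')) / (d₀' + d₁' − dim_K(W')) ≤ (d₁ − dim_ℚ(Y ∩ Ω)) / (d₀ + d₁ − dim_K(V))`."
  In the notation of §2 (p. 27: `a(X) = d₁ − dim_ℚ(Y ∩ Ω)`, `b(X) = d₀ + d₁ − dim_K(V)`,
  `c(X) = dim_ℚ(Y)`, `d(X) = dim_K(V/W)`) this is Theorem 1bis: "there exists a cokernel
  `s : X → X'` … such that `b(X') + d(X') ≠ 0` and `(a(X') + c(X'))/(b(X') + d(X')) ≤ a(X)/b(X)`".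
  Dictionary with [Waldschmidt1988, Theorem 4.1] (for `G = G_a^{d₀} × G_m^{d₁}`, `d₂ = 0`,
  `G' = ker`-group of `s`, `n = dim V`): `δ₀ = d₀'`, `δ₁ = d₁'`, `τ = dim W'`,
  `λ = dim_ℚ Y' − dim_ℚ(Y' ∩ Ω')`, `κ = dim_ℚ(Y ∩ Ω)`; the printed conclusion "`δ > τ` and
  `(λ + δ₁ + 2δ₂)(d − n) ≤ (δ − τ)(d₁ + 2d₂ − κ)`" is the displayed inequality, cross-multiplied.
* [Roy1992, §1 Theorem 2, p. 25] (proved in §3 as Theorem 2bis): "Let `d₀, d₁, Y, W, V` be as in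
  Theorem 1, with `V ≠ K^{d₀} × K^{d₁}`. Consider the set of all surjective `K`-linear mappings
  `s : K^{d₀} × K^{d₁} → K^{d₀'} × K^{d₁'}` satisfying `s(ℚ̄^{d₀} × 0) ⊆ ℚ̄^{d₀'} × 0`,
  `s(0 × ℚ^{d₁}) ⊆ 0 × ℚ^{d₁'}`, `s(V) ≠ K^{d₀'} × K^{d₁'}`. In this set, there exists at least one
  mapping `s` for which the ratio `d₁'/(d₀' + d₁' − dim_K(s(V)))` is minimal, and for which
  `s(V) ∩ (ℚ̄^{d₀'} × 0) = 0`. For such an `s`, we have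
  `(d₁' + dim_ℚ(s(Y))) / (d₀' + d₁' − dim_K(s(W))) ≤ d₁' / (d₀' + d₁' − dim_K(s(V))) ≤ (d₁ − dim_ℚ(Y ∩ Ω)) / (d₀ + d₁ − dim_K(V))`,
  letting `Ω = 0 × ωℚ^{d₁}`." ("For such an `s`" = every minimising `s` with
  `s(V) ∩ (ℚ̄^{d₀'} × 0) = 0`: this is how the theorem is applied on p. 35 — "Let us show that we
  can choose the identity mapping … This amounts on the one hand to showing `V ∩ (ℚ̄^d × 0) = 0`
  (4) and on the other hand to showing (5)" — and how it is proved on p. 33, "Let `s : X → X'` be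
  an element of `E₁` for which there does not exist any kernel …".)

## Lean rendering

* `K = ℂ`; the ambient space is `LinTangent d₀ d₁ = (Fin d₀ → ℂ) × (Fin d₁ → ℂ)`;
  `ℚ̄ = algebraicClosure ℚ ℂ`; `L = {z | e^z ∈ ℚ̄}` pointwise (`IsAlgebraic ℚ (cexp z)`, as in the
  companions and `Literature.NumberTheory.Transcendental.baker`); `ω = 2πi`.
* `IsQbarPoint v` (`v ∈ ℚ̄^{d₀} × ℚ̄^{d₁}`), `IsQbarRational W` (`W` is the `ℂ`-span of its
  `ℚ̄`-points, i.e. rational over `ℚ̄` for the structure `ℚ̄^{d₀} × ℚ̄^{d₁}`), `Omega d₀ d₁`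
  (`Ω = 0 × ωℚ^{d₁}` as a `ℚ`-submodule), `IsAdmissible s` (surjective, `s(ℚ̄^{d₀} × 0) ⊆ ℚ̄^{d₀'} × 0`,
  `s(0 × ℚ^{d₁}) ⊆ 0 × ℚ^{d₁'}`).
* `roy1992_thm1`, `roy1992_thm2` — the two theorems, with all dimensions cast to `ℝ` (no natural
  subtraction; the printed denominators are positive: `V ≠ K^{d₀} × K^{d₁}`, `W' ≠ K^{d₀'} × K^{d₁'}`,
  `s(V) ≠ K^{d₀'} × K^{d₁'}`), images `s(Y)` taken with `s` restricted to `ℚ`-scalars, and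
  `dim_ℚ(Y ∩ Ω)` as `finrank ℚ ↥(Y ⊓ Omega d₀ d₁)`.

What is NOT here: the proofs (Theorem 1: [Waldschmidt1988, §§5–7]; Theorem 2 from Theorem 1:
[Roy1992, §§2–3]) and the deduction of Theorem 4 from Theorem 2 ([Roy1992, pp. 34–37]).

## References

* [Roy1992] D. Roy, *Matrices whose coefficients are linear forms in logarithms*, J. Number
  Theory 41 (1992) 22–47: Notations p. 24; §1 Theorem 1 and Theorem 2 (p. 25); §2 (functions
  `a, b, c, d`, Theorems 1bis and 2bis, p. 27); §3 (proof of Theorem 2bis, pp. 29–34); §4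
  (application of Theorem 2, p. 35).
* [Waldschmidt1988] M. Waldschmidt, *On the transcendence methods of Gel'fond and Schneider in
  several variables*, in: New Advances in Transcendence Theory (A. Baker ed.), Cambridge Univ.
  Press 1988, 375–398: §4 Theorem 4.1 (statement and the remark following it); §§6–7 (proof).
-/

noncomputable section

open Complex Module

namespace Literature.Barriers.Schanuel

/-! ### The ambient space `K^{d₀} × K^{d₁}` and its rational structures -/

/-- The tangent space `K^{d₀} × K^{d₁}` (`K = ℂ`) of the linear group `G_a^{d₀} × G_m^{d₁}` at the
neutral element. [cite: Roy1992, §1 (before Theorem 1, p. 25)] -/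
abbrev LinTangent (d₀ d₁ : ℕ) : Type := (Fin d₀ → ℂ) × (Fin d₁ → ℂ)

variable {d₀ d₁ d₀' d₁' : ℕ}

/-- `v ∈ ℚ̄^{d₀} × ℚ̄^{d₁}` (all coordinates algebraic). [cite: Roy1992, Notations (p. 24)] -/
def IsQbarPoint (v : LinTangent d₀ d₁) : Prop :=
  (∀ i, v.1 i ∈ algebraicClosure ℚ ℂ) ∧ ∀ j, v.2 j ∈ algebraicClosure ℚ ℂ

/-- A `K`-subspace `W ⊆ K^{d₀} × K^{d₁}` is **rational over `ℚ̄`** if it is generated over `K` by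
elements of `ℚ̄^{d₀} × ℚ̄^{d₁}` (equivalently: `W` is the `ℂ`-span of its own `ℚ̄`-points).
[cite: Roy1992, Notations (p. 24)] -/
def IsQbarRational (W : Submodule ℂ (LinTangent d₀ d₁)) : Prop :=
  W = Submodule.span ℂ {v | v ∈ W ∧ IsQbarPoint v}

/-- `Ω = 0 × ωℚ^{d₁}`, `ω = 2πi`: the `ℚ`-subspace of `K^{d₀} × K^{d₁}` spanned by the vectors
`(0, 2πi·e_j)` (the rational multiples of the periods of `exp` on the factor `G_m^{d₁}`).
[cite: Roy1992, §1 Theorem 1 (p. 25)] -/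
def Omega (d₀ d₁ : ℕ) : Submodule ℚ (LinTangent d₀ d₁) :=
  Submodule.span ℚ (Set.range fun j : Fin d₁ =>
    ((0 : Fin d₀ → ℂ), Pi.single j (2 * (Real.pi : ℂ) * I)))

/-- The maps `s : K^{d₀} × K^{d₁} → K^{d₀'} × K^{d₁'}` of Theorems 1–2: surjective, `K`-linear, with
`s(ℚ̄^{d₀} × 0) ⊆ ℚ̄^{d₀'} × 0` and `s(0 × ℚ^{d₁}) ⊆ 0 × ℚ^{d₁'}`.
[cite: Roy1992, §1 Theorem 1 (p. 25)] -/
def IsAdmissible (s : LinTangent d₀ d₁ →ₗ[ℂ] LinTangent d₀' d₁') : Prop :=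
  Function.Surjective s ∧
    (∀ x : Fin d₀ → ℂ, (∀ i, x i ∈ algebraicClosure ℚ ℂ) →
      (∀ i, (s (x, 0)).1 i ∈ algebraicClosure ℚ ℂ) ∧ (s (x, 0)).2 = 0) ∧
    (∀ y : Fin d₁ → ℂ, (∀ j, y j ∈ Set.range ((↑) : ℚ → ℂ)) →
      (s (0, y)).1 = 0 ∧ ∀ j, (s (0, y)).2 j ∈ Set.range ((↑) : ℚ → ℂ))

/-- The identity is admissible. [folklore] -/
theorem isAdmissible_id (d₀ d₁ : ℕ) :
    IsAdmissible (LinearMap.id : LinTangent d₀ d₁ →ₗ[ℂ] LinTangent d₀ d₁) :=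
  ⟨Function.surjective_id, fun _ hx => ⟨hx, rfl⟩, fun _ hy => ⟨rfl, hy⟩⟩

/-- The zero subspace is rational over `ℚ̄`. [folklore] -/
theorem isQbarRational_bot : IsQbarRational (⊥ : Submodule ℂ (LinTangent d₀ d₁)) := by
  unfold IsQbarRational
  refine le_antisymm bot_le (Submodule.span_le.2 ?_)
  rintro v ⟨hv, -⟩
  exact hv

/-- `Y ⊆ ℚ̄^{d₀} × L^{d₁}`: the first `d₀` coordinates of every element of `Y` are algebraic and the
last `d₁` are logarithms of algebraic numbers (`e^{y_j} ∈ ℚ̄`). [cite: Roy1992, §1 Theorem 1 (p. 25)] -/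
def IsQbarLogSubspace (Y : Submodule ℚ (LinTangent d₀ d₁)) : Prop :=
  ∀ y ∈ Y, (∀ i, y.1 i ∈ algebraicClosure ℚ ℂ) ∧ ∀ j, IsAlgebraic ℚ (cexp (y.2 j))

/-! ### Theorem 1 (M. Waldschmidt) and Theorem 2 (Roy) as named facts -/

/-- **Roy 1992, Theorem 1 (M. Waldschmidt) — Theorem 4.1 of [Waldschmidt1988] for the linear
group `G_a^{d₀} × G_m^{d₁}`.** "Let `d₀, d₁` be integers `≥ 0`, `Y` be a finite dimensional
`ℚ`-vector subspace of `K^{d₀} × K^{d₁}` contained in `ℚ̄^{d₀} × L^{d₁}`, `W` be a `K`-vector subspace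
of `K^{d₀} × K^{d₁}` which is rational over `ℚ̄`, `V` be a `K`-vector subspace of `K^{d₀} × K^{d₁}`
containing `Y` and `W`. If `V ≠ K^{d₀} × K^{d₁}`, there exists a surjective `K`-linear mapping
`s : K^{d₀} × K^{d₁} → K^{d₀'} × K^{d₁'}` satisfying `s(ℚ̄^{d₀} × 0) ⊆ ℚ̄^{d₀'} × 0` and
`s(0 × ℚ^{d₁}) ⊆ 0 × ℚ^{d₁'}`, such that, letting `Y' = s(Y)`, `W' = s(W)`, `V' = s(V)`,
`Ω = 0 × ωℚ^{d₁}`, and `Ω' = 0 × ωℚ^{d₁'}`, we have `W' ≠ K^{d₀'} × K^{d₁'}` and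
`(d₁' − dim_ℚ(Y' ∩ Ω') + dim_ℚ(Y')) / (d₀' + d₁' − dim_K(W')) ≤ (d₁ − dim_ℚ(Y ∩ Ω)) / (d₀ + d₁ − dim_K(V))`."
(`K = ℂ`, `ω = 2πi`; dimensions cast to `ℝ`, both denominators being positive.) This is the
transcendence input of Roy's chain (auxiliary function + Philippon's zero estimate in print);
named fact, users take `(h : roy1992_thm1)`.
[cite: Roy1992, §1 Theorem 1 (p. 25)] [cite: Waldschmidt1988, §4 Theorem 4.1] -/
def roy1992_thm1 : Prop :=
  ∀ (d₀ d₁ : ℕ) (Y : Submodule ℚ (LinTangent d₀ d₁)) (W V : Submodule ℂ (LinTangent d₀ d₁)),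
    FiniteDimensional ℚ Y → IsQbarLogSubspace Y → IsQbarRational W →
    Y ≤ V.restrictScalars ℚ → W ≤ V → V ≠ ⊤ →
    ∃ (d₀' d₁' : ℕ) (s : LinTangent d₀ d₁ →ₗ[ℂ] LinTangent d₀' d₁'), IsAdmissible s ∧
      W.map s ≠ ⊤ ∧
      ((d₁' : ℝ) - finrank ℚ ↥(Y.map (s.restrictScalars ℚ) ⊓ Omega d₀' d₁')
          + finrank ℚ ↥(Y.map (s.restrictScalars ℚ))) /
          ((d₀' : ℝ) + d₁' - finrank ℂ ↥(W.map s)) ≤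
        ((d₁ : ℝ) - finrank ℚ ↥(Y ⊓ Omega d₀ d₁)) / ((d₀ : ℝ) + d₁ - finrank ℂ ↥V)

/-- The ratio `d₁'/(d₀' + d₁' − dim_K(s(V)))` minimised in Theorem 2. [cite: Roy1992, §1 Theorem 2 (p. 25)] -/
def thm2Ratio (V : Submodule ℂ (LinTangent d₀ d₁)) (d₀' d₁' : ℕ)
    (s : LinTangent d₀ d₁ →ₗ[ℂ] LinTangent d₀' d₁') : ℝ :=
  (d₁' : ℝ) / ((d₀' : ℝ) + d₁' - finrank ℂ ↥(V.map s))

/-- The set of maps considered in Theorem 2: admissible `s` with `s(V) ≠ K^{d₀'} × K^{d₁'}`, and the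
minimality of the ratio `d₁'/(d₀' + d₁' − dim_K(s(V)))` over that set.
[cite: Roy1992, §1 Theorem 2 (p. 25)] -/
def IsThm2Minimal (V : Submodule ℂ (LinTangent d₀ d₁)) (d₀' d₁' : ℕ)
    (s : LinTangent d₀ d₁ →ₗ[ℂ] LinTangent d₀' d₁') : Prop :=
  IsAdmissible s ∧ V.map s ≠ ⊤ ∧
    ∀ (d₀'' d₁'' : ℕ) (s' : LinTangent d₀ d₁ →ₗ[ℂ] LinTangent d₀'' d₁''),
      IsAdmissible s' → V.map s' ≠ ⊤ → thm2Ratio V d₀' d₁' s ≤ thm2Ratio V d₀'' d₁'' s'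

/-- **Roy 1992, Theorem 2** (Roy's refinement of Theorem 1, proved in §§2–3 from it). "Let
`d₀, d₁, Y, W, V` be as in Theorem 1, with `V ≠ K^{d₀} × K^{d₁}`. Consider the set of all
surjective `K`-linear mappings `s : K^{d₀} × K^{d₁} → K^{d₀'} × K^{d₁'}` satisfying
`s(ℚ̄^{d₀} × 0) ⊆ ℚ̄^{d₀'} × 0`, `s(0 × ℚ^{d₁}) ⊆ 0 × ℚ^{d₁'}`, `s(V) ≠ K^{d₀'} × K^{d₁'}`. In this
set, there exists at least one mapping `s` for which the ratio `d₁'/(d₀' + d₁' − dim_K(s(V)))` is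
minimal, and for which `s(V) ∩ (ℚ̄^{d₀'} × 0) = 0`. For such an `s`, we have
`(d₁' + dim_ℚ(s(Y))) / (d₀' + d₁' − dim_K(s(W))) ≤ d₁' / (d₀' + d₁' − dim_K(s(V))) ≤ (d₁ − dim_ℚ(Y ∩ Ω)) / (d₀ + d₁ − dim_K(V))`,
letting `Ω = 0 × ωℚ^{d₁}`." Rendered as the conjunction of the existence statement and of the
inequalities for every minimising `s` with `s(V) ∩ (ℚ̄^{d₀'} × 0) = 0` (the form in which it is
applied on p. 35 and proved on p. 33); dimensions cast to `ℝ`. Named fact, users take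
`(h : roy1992_thm2)`. [cite: Roy1992, §1 Theorem 2 (p. 25)] -/
def roy1992_thm2 : Prop :=
  ∀ (d₀ d₁ : ℕ) (Y : Submodule ℚ (LinTangent d₀ d₁)) (W V : Submodule ℂ (LinTangent d₀ d₁)),
    FiniteDimensional ℚ Y → IsQbarLogSubspace Y → IsQbarRational W →
    Y ≤ V.restrictScalars ℚ → W ≤ V → V ≠ ⊤ →
    (∃ (d₀' d₁' : ℕ) (s : LinTangent d₀ d₁ →ₗ[ℂ] LinTangent d₀' d₁'), IsThm2Minimal V d₀' d₁' s ∧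
      ∀ v ∈ V.map s, (∀ i, v.1 i ∈ algebraicClosure ℚ ℂ) → v.2 = 0 → v = 0) ∧
    ∀ (d₀' d₁' : ℕ) (s : LinTangent d₀ d₁ →ₗ[ℂ] LinTangent d₀' d₁'), IsThm2Minimal V d₀' d₁' s →
      (∀ v ∈ V.map s, (∀ i, v.1 i ∈ algebraicClosure ℚ ℂ) → v.2 = 0 → v = 0) →
      ((d₁' : ℝ) + finrank ℚ ↥(Y.map (s.restrictScalars ℚ))) /
            ((d₀' : ℝ) + d₁' - finrank ℂ ↥(W.map s)) ≤ thm2Ratio V d₀' d₁' s ∧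
        thm2Ratio V d₀' d₁' s ≤
          ((d₁ : ℝ) - finrank ℚ ↥(Y ⊓ Omega d₀ d₁)) / ((d₀ : ℝ) + d₁ - finrank ℂ ↥V)

end Literature.Barriers.Schanuel
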